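import Literature.MathematicalPhysics.QuantumFieldTheory.Balaban1983to89.B1Eq324BenfattoSect5RegionCount
import Literature.MathematicalPhysics.QuantumFieldTheory.Balaban1983to89.B1Eq324BenfattoSect5Eq511
import HarnessLib

/-!
# `Balaban1983to89.B1Eq324BenfattoSect5FreeStepCrossMasses` — [BenfattoEtAl1978] §5 p. 159: the decay-weighted class masses
# `W_m(c)` displayed by `…Sect5FreeStepCross.abs_cross_le_sum_anchor` are UNIFORMLY bounded, and the far ones carry the gain
# `e^{−(c₂/2)·r₀}` — lattice-sum evaluation (R1b), PROVED from the sibling seat's `…Sect5RegionCount`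

statement-level skeleton of published theorems with citation tags; proofs where landed; nothing here is a claim about the
Yang–Mills mass gap

WHY THIS MODULE (cell `pub-ymgap`, seat `dag-n08-b`, node N08; item (R1b) of the `BasicLemmaPrinted` assembly map).
`…Sect5FreeStepCross.abs_cross_le_sum_anchor` bounds the CROSS colourings of one pavement step by
`C·Σ_m (k+1)k·W_m(m,true)·W^far_m·(Σ_c W_m(c))^{k−1}` with the decay-weighted masses
`W_m(c) = Σ_{cls c} |A^n_Δ|e^{−(ϰ/2)d(Δ)}·e^{(δ/2)D²(√d·d(Δ)+d)}·e^{−c₂ρ_m(Δ₀)}`, `c₂ = δ/(2(k+1))`, `ρ_m` an `ℓ¹`-length to the deep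
region `R_A = □′_m∖Γ₄(□_m)`.  This file evaluates them with `…RegionCount.decayWeighted_classSum_le_card_mul` («group by the anchor,
sum the other tesserae freely»): (i) ANY class — even the volume-size rest class `H_{Γ₁}` — has
`W ≤ A·e^{(δ/2)D²d}·|R_A|·K(c₂,d)·S(ϰ/2 − (δ/2)D²√d)`, uniformly in the volume; (ii) a class whose anchors are at `ρ_m ≥ r₀` (the
far classes: `r₀ = w+v+1` across `Γ₂∪Γ₃∪Γ₄`) has the same bound with `K(c₂/2,d)` and the GAIN `e^{−(c₂/2)r₀}`; (iii) the bookkeeping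
identity turning a sum of colour classes into one class (pairwise disjoint classes), so that `W^far_m` and `Σ_c W_m(c)` are single
class sums to which (i)/(ii) apply.

DICTIONARY.  `K(c,d) = (2/(1−e^{−c/√d})·e^{c/√d})^d` (the `ℓ¹`/cube lattice constant of `…CrossCount`/`…RegionCount`),
`S(c) = Σ_{p∈Icc 1 s}|admissible p D|·K(c/p,d)^{p−1}` (the tuple-shape sum of `…SlotMasses`); anchor `Δ₀ = Δ⟨0⟩` written as
`if h : 0 < p then Δ⟨0,h⟩ else 0` (the shape of `…TupleClustersDecay`).

WHAT IS PROVED (theorems only; no definition, no named fact, no `sorry`; axioms standard).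
* ★ **`decayWeightedMass_le`** — (i).   * ★ **`decayWeightedMass_le_of_far`** — (ii).
* `sum_classSum_eq_classSum_biUnion` — (iii): `Σ_{c∈Sc} Σ_pΣ_{Δ∈cls c p}Σ_n F = Σ_pΣ_{Δ∈⋃_{c∈Sc} cls c p}Σ_n F` for pairwise disjoint classes.

HONEST SCOPE / NOT HERE.  The instantiation on print's classes (`|R_A| ≤ |□| = L^d`, `r₀ = w+v+1` by
`…LegGeometry.le_l1_of_mem_shrink_of_not_mem_shrink`) and the assembly are NOT here.  `BasicLemmaPrinted` stays OPEN.  NOT summit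
progress; count-neutral for N08; nothing of [Balaban1985UV3] (41)/(47)/(5) is asserted.
-/

open Finset
open scoped BigOperators

namespace Literature.MathematicalPhysics.QuantumFieldTheory.Balaban1983to89.B1Eq324BenfattoSect5FreeStepCrossMasses

open Literature.MathematicalPhysics.QuantumFieldTheory
open Literature.MathematicalPhysics.QuantumFieldTheory.Balaban1983to89.B1Eq324BenfattoLemma
open Literature.MathematicalPhysics.QuantumFieldTheory.Balaban1983to89.B1Eq324BenfattoSect5RegionCount
  (decayWeighted_classSum_le_card_mul)

variable {d : ℕ} {s D : ℕ} {ϰ : ℝ} {a : Coef d} {Jr : Finset (B1Eq324BenfattoLemma.Site d)}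

/-- **(iii) A SUM OF DISJOINT COLOUR CLASSES IS ONE CLASS** (the bookkeeping behind «Collecting all the errors»: the far colours of
an anchor, or all colours, summed as one tuple class). [cite: BenfattoEtAl1978, §5 p.159] -/
theorem sum_classSum_eq_classSum_biUnion {P : Type*} [DecidableEq P] (Sc : Finset P)
    (cls : P → (p : ℕ) → Finset (Fin p → Jr)) (hdisj : ∀ p, ∀ c₁ ∈ Sc, ∀ c₂ ∈ Sc, c₁ ≠ c₂ → Disjoint (cls c₁ p) (cls c₂ p))
    (F : (p : ℕ) → (Fin p → Jr) → (Fin p → ℕ) → ℝ) :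
    ∑ c ∈ Sc, ∑ p ∈ Finset.Icc 1 s, ∑ Δ ∈ cls c p, ∑ n ∈ admissible p D, F p Δ n =
      ∑ p ∈ Finset.Icc 1 s, ∑ Δ ∈ Sc.biUnion (fun c => cls c p), ∑ n ∈ admissible p D, F p Δ n := by
  classical
  rw [Finset.sum_comm]
  refine Finset.sum_congr rfl fun p _ => ?_
  rw [Finset.sum_biUnion (fun c₁ hc₁ c₂ hc₂ hne => hdisj p c₁ hc₁ c₂ hc₂ hne)]

/-- The decay-weighted summand in the shape of `…TupleClustersDecay` rewritten as `A'·e^{−c·d(Δ)}·e^{−c₂ρ(Δ₀)}`-bounded weight.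
[cite: BenfattoEtAl1978, (5.29) p.158] -/
private theorem crossSummand_le {c₂ A : ℝ} (δ : ℝ) (hA : ∀ (p : ℕ) (Δ : Fin p → B1Eq324BenfattoLemma.Site d) (n : Fin p → ℕ), |a p Δ n| ≤ A)
    (ρ : B1Eq324BenfattoLemma.Site d → ℝ) {p : ℕ} (hp : p ∈ Finset.Icc 1 s) (Δ : Fin p → Jr) (n : Fin p → ℕ) :
    |a p (fun i => (Δ i : B1Eq324BenfattoLemma.Site d)) n| *
        Real.exp (-(ϰ / 2) * connLength fun i => (Δ i : B1Eq324BenfattoLemma.Site d)) *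
        (Real.exp (δ / 2 * ((D : ℝ) ^ 2 * (Real.sqrt d * connLength (fun i => (Δ i : B1Eq324BenfattoLemma.Site d)) + d))) *
          Real.exp (-(c₂ * ρ (if h : 0 < p then (Δ ⟨0, h⟩ : B1Eq324BenfattoLemma.Site d) else 0)))) ≤
      A * Real.exp (δ / 2 * ((D : ℝ) ^ 2 * d)) *
        Real.exp (-((ϰ / 2 - δ / 2 * ((D : ℝ) ^ 2 * Real.sqrt d)) * connLength fun i => (Δ i : B1Eq324BenfattoLemma.Site d))) *
        Real.exp (-(c₂ * ρ (Δ ⟨0, (Finset.mem_Icc.1 hp).1⟩ : B1Eq324BenfattoLemma.Site d))) := by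
  have hp1 : 0 < p := (Finset.mem_Icc.1 hp).1
  rw [dif_pos hp1]
  set ℓ := connLength (fun i => (Δ i : B1Eq324BenfattoLemma.Site d)) with hℓ
  have hexp : Real.exp (-(ϰ / 2) * ℓ) * Real.exp (δ / 2 * ((D : ℝ) ^ 2 * (Real.sqrt d * ℓ + d))) =
      Real.exp (δ / 2 * ((D : ℝ) ^ 2 * d)) * Real.exp (-((ϰ / 2 - δ / 2 * ((D : ℝ) ^ 2 * Real.sqrt d)) * ℓ)) := by
    rw [← Real.exp_add, ← Real.exp_add]
    congr 1
    ring
  calc |a p (fun i => (Δ i : B1Eq324BenfattoLemma.Site d)) n| * Real.exp (-(ϰ / 2) * ℓ) *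
        (Real.exp (δ / 2 * ((D : ℝ) ^ 2 * (Real.sqrt d * ℓ + d))) *
          Real.exp (-(c₂ * ρ (Δ ⟨0, hp1⟩ : B1Eq324BenfattoLemma.Site d))))
      = |a p (fun i => (Δ i : B1Eq324BenfattoLemma.Site d)) n| *
          (Real.exp (δ / 2 * ((D : ℝ) ^ 2 * d)) * Real.exp (-((ϰ / 2 - δ / 2 * ((D : ℝ) ^ 2 * Real.sqrt d)) * ℓ))) *
          Real.exp (-(c₂ * ρ (Δ ⟨0, hp1⟩ : B1Eq324BenfattoLemma.Site d))) := by
        rw [← hexp]; ring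
    _ ≤ A * (Real.exp (δ / 2 * ((D : ℝ) ^ 2 * d)) * Real.exp (-((ϰ / 2 - δ / 2 * ((D : ℝ) ^ 2 * Real.sqrt d)) * ℓ))) *
          Real.exp (-(c₂ * ρ (Δ ⟨0, hp1⟩ : B1Eq324BenfattoLemma.Site d))) :=
        mul_le_mul_of_nonneg_right (mul_le_mul_of_nonneg_right (hA p _ n) (by positivity)) (Real.exp_pos _).le
    _ = _ := by ring

/-- **(i) EVERY DECAY-WEIGHTED CLASS MASS IS `O(1)` IN THE VOLUME**: for a tuple class over `J`, coefficients `|A^n_Δ| ≤ A`, a rate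
budget `ϰ/2 > (δ/2)D²√d`, an anchor rate `c₂ > 0` and a length `ρ` with `ρ(y) ≥ ℓ¹(x_y, y)` for some `x_y ∈ R_A` (e.g. the
`ℓ¹`-distance to `R_A`): `W ≤ A·e^{(δ/2)D²d}·(|R_A|·K(c₂,d))·S(ϰ/2 − (δ/2)D²√d)` — the rest class of a whole volume included.
[cite: BenfattoEtAl1978, §5 p.159, Appendix D p.166] -/
theorem decayWeightedMass_le {δ c₂ A : ℝ} (hres : 0 < ϰ / 2 - δ / 2 * ((D : ℝ) ^ 2 * Real.sqrt d)) (hc₂ : 0 < c₂) (hA0 : 0 ≤ A)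
    (hA : ∀ (p : ℕ) (Δ : Fin p → B1Eq324BenfattoLemma.Site d) (n : Fin p → ℕ), |a p Δ n| ≤ A)
    (cls : (p : ℕ) → Finset (Fin p → Jr)) (RA : Finset (B1Eq324BenfattoLemma.Site d)) (ρ : B1Eq324BenfattoLemma.Site d → ℝ)
    (hρ : ∀ y ∈ Jr, ∃ x ∈ RA, (∑ j, |((x j : ℝ) - (y j : ℝ))|) ≤ ρ y) :
    ∑ p ∈ Finset.Icc 1 s, ∑ Δ ∈ cls p, ∑ n ∈ admissible p D,
        |a p (fun i => (Δ i : B1Eq324BenfattoLemma.Site d)) n| *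
          Real.exp (-(ϰ / 2) * connLength fun i => (Δ i : B1Eq324BenfattoLemma.Site d)) *
          (Real.exp (δ / 2 * ((D : ℝ) ^ 2 * (Real.sqrt d * connLength (fun i => (Δ i : B1Eq324BenfattoLemma.Site d)) + d))) *
            Real.exp (-(c₂ * ρ (if h : 0 < p then (Δ ⟨0, h⟩ : B1Eq324BenfattoLemma.Site d) else 0)))) ≤
      A * Real.exp (δ / 2 * ((D : ℝ) ^ 2 * d)) *
        (RA.card * (2 / (1 - Real.exp (-(c₂ / Real.sqrt d))) * Real.exp (c₂ / Real.sqrt d)) ^ d) *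
        ∑ p ∈ Finset.Icc 1 s, ((admissible p D).card : ℝ) *
          ((2 / (1 - Real.exp (-((ϰ / 2 - δ / 2 * ((D : ℝ) ^ 2 * Real.sqrt d)) / (p : ℕ) / Real.sqrt d))) *
            Real.exp ((ϰ / 2 - δ / 2 * ((D : ℝ) ^ 2 * Real.sqrt d)) / (p : ℕ) / Real.sqrt d)) ^ d) ^ (p - 1) :=
  decayWeighted_classSum_le_card_mul hres hc₂ (mul_nonneg hA0 (Real.exp_pos _).le) cls RA ρ hρ _
    fun _ hp Δ _ n _ => crossSummand_le δ hA ρ hp Δ n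

/-- **(ii) A FAR CLASS CARRIES THE GAIN**: if moreover every anchor of the class has `ρ(Δ₀) ≥ r₀`, then
`W ≤ A·e^{(δ/2)D²d}·e^{−(c₂/2)r₀}·(|R_A|·K(c₂/2,d))·S` (split `e^{−c₂ρ} = e^{−(c₂/2)ρ}·e^{−(c₂/2)ρ} ≤ e^{−(c₂/2)r₀}·e^{−(c₂/2)ρ}`).
[cite: BenfattoEtAl1978, §5 p.159, Appendix D p.166] -/
theorem decayWeightedMass_le_of_far {δ c₂ A r₀ : ℝ} (hres : 0 < ϰ / 2 - δ / 2 * ((D : ℝ) ^ 2 * Real.sqrt d)) (hc₂ : 0 < c₂)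
    (hA0 : 0 ≤ A) (hA : ∀ (p : ℕ) (Δ : Fin p → B1Eq324BenfattoLemma.Site d) (n : Fin p → ℕ), |a p Δ n| ≤ A)
    (cls : (p : ℕ) → Finset (Fin p → Jr)) (RA : Finset (B1Eq324BenfattoLemma.Site d)) (ρ : B1Eq324BenfattoLemma.Site d → ℝ)
    (hρ : ∀ y ∈ Jr, ∃ x ∈ RA, (∑ j, |((x j : ℝ) - (y j : ℝ))|) ≤ ρ y)
    (hfar : ∀ p (hp : p ∈ Finset.Icc 1 s), ∀ Δ ∈ cls p, r₀ ≤ ρ (Δ ⟨0, (Finset.mem_Icc.1 hp).1⟩ : B1Eq324BenfattoLemma.Site d)) :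
    ∑ p ∈ Finset.Icc 1 s, ∑ Δ ∈ cls p, ∑ n ∈ admissible p D,
        |a p (fun i => (Δ i : B1Eq324BenfattoLemma.Site d)) n| *
          Real.exp (-(ϰ / 2) * connLength fun i => (Δ i : B1Eq324BenfattoLemma.Site d)) *
          (Real.exp (δ / 2 * ((D : ℝ) ^ 2 * (Real.sqrt d * connLength (fun i => (Δ i : B1Eq324BenfattoLemma.Site d)) + d))) *
            Real.exp (-(c₂ * ρ (if h : 0 < p then (Δ ⟨0, h⟩ : B1Eq324BenfattoLemma.Site d) else 0)))) ≤
      A * Real.exp (δ / 2 * ((D : ℝ) ^ 2 * d)) * Real.exp (-(c₂ / 2 * r₀)) *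
        (RA.card * (2 / (1 - Real.exp (-(c₂ / 2 / Real.sqrt d))) * Real.exp (c₂ / 2 / Real.sqrt d)) ^ d) *
        ∑ p ∈ Finset.Icc 1 s, ((admissible p D).card : ℝ) *
          ((2 / (1 - Real.exp (-((ϰ / 2 - δ / 2 * ((D : ℝ) ^ 2 * Real.sqrt d)) / (p : ℕ) / Real.sqrt d))) *
            Real.exp ((ϰ / 2 - δ / 2 * ((D : ℝ) ^ 2 * Real.sqrt d)) / (p : ℕ) / Real.sqrt d)) ^ d) ^ (p - 1) := by
  refine decayWeighted_classSum_le_card_mul hres (half_pos hc₂)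
    (mul_nonneg (mul_nonneg hA0 (Real.exp_pos _).le) (Real.exp_pos _).le) cls RA ρ hρ _ fun p hp Δ hΔ n _ => ?_
  refine (crossSummand_le δ hA ρ hp Δ n).trans ?_
  have hsplit : Real.exp (-(c₂ * ρ (Δ ⟨0, (Finset.mem_Icc.1 hp).1⟩ : B1Eq324BenfattoLemma.Site d))) ≤
      Real.exp (-(c₂ / 2 * r₀)) * Real.exp (-(c₂ / 2 * ρ (Δ ⟨0, (Finset.mem_Icc.1 hp).1⟩ : B1Eq324BenfattoLemma.Site d))) := by
    rw [← Real.exp_add]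
    refine Real.exp_le_exp.2 ?_
    have h := hfar p hp Δ hΔ
    nlinarith
  have h0 : 0 ≤ A * Real.exp (δ / 2 * ((D : ℝ) ^ 2 * d)) *
      Real.exp (-((ϰ / 2 - δ / 2 * ((D : ℝ) ^ 2 * Real.sqrt d)) * connLength fun i => (Δ i : B1Eq324BenfattoLemma.Site d))) :=
    by positivity
  calc _ ≤ A * Real.exp (δ / 2 * ((D : ℝ) ^ 2 * d)) *
        Real.exp (-((ϰ / 2 - δ / 2 * ((D : ℝ) ^ 2 * Real.sqrt d)) * connLength fun i => (Δ i : B1Eq324BenfattoLemma.Site d))) *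
        (Real.exp (-(c₂ / 2 * r₀)) * Real.exp (-(c₂ / 2 * ρ (Δ ⟨0, (Finset.mem_Icc.1 hp).1⟩ : B1Eq324BenfattoLemma.Site d)))) :=
        mul_le_mul_of_nonneg_left hsplit h0
    _ = _ := by ring

end Literature.MathematicalPhysics.QuantumFieldTheory.Balaban1983to89.B1Eq324BenfattoSect5FreeStepCrossMasses
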